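import Literature.IUT.HodgeTheaters.InitialThetaDataOfModelPlaces

/-!
# [IUTchI] Definition 3.1 (e)(f): the section `V̲` CHOSEN through admissible bad places
# (repair companion of the smart constructor `InitialThetaData.ofArith`, additive, proof/defs only)

S. Mochizuki, *Inter-universal Teichmüller theory I*, RIMS manuscript (May 2020), Def. 3.1 (e) p. 62 l.–8 –
p. 63 l. 5 («`V̲ ⊆ V(K)` is a subset that induces a natural bijection `V̲ ⥲ V_mod`, i.e., a section of the
natural surjection `V(K) ↠ V_mod` … If `v̲ ∈ V̲^bad`, then we assume further that the hyperbolic orbicurve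
`C̲_v̲` is of type `(1, ℤ/lℤ)±`»), (f) p. 63 l. 22–26 («If `v̲ ∈ V̲^bad`, then we assume that `ε̲_v̲` is the cusp
that arises from the canonical generator [up to sign]»); [IUTchIV] Cor. 2.2 (ii), proof, p. 46 («there exist
data `C̲_K`, `V̲`, `ε̲` such that all of the conditions … (a), (b), (c), (d), (e), (f), are satisfied»).
[cite: Mochizuki2012, IUTchI Def 3.1 (e) p.62] — claim key DISPUTED (D-0012); this file is classical
bookkeeping (a choice of places) and asserts nothing of the series; no side is taken on [IUTchIII] Cor. 3.12.

WHY THIS FILE. `InitialThetaData.ofArith` (InitialThetaDataArith.lean) takes `V̲ :=` the image of an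
ARBITRARY section (`Function.surjInv`) and therefore has to assume the two bad-place clauses of (e)/(f) at
EVERY place `w ∈ V(K)` over `V^bad_mod` (`hbad_type`, `hbad_cusp : ∀ w, toVMod w ∈ V^bad_mod → …`). Print
assumes them only at the CHOSEN `v̲ ∈ V̲^bad`, and in the intended model the universal form fails: with
`SL₂(𝔽_l) ⊆ Im(G_F → GL₂(𝔽_l))` ((c)) the group `Gal(K/F)` permutes the `l+1` lines of `E_F[l]` transitively
while the decomposition group of a place of multiplicative reduction stabilises the canonical multiplicative
line, so above each bad place there are places `w` of `K` whose canonical line is NOT the kernel of the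
quotient `E_F[l] ↠ Q` defining `C̲_K` — at such `w` the curve `C̲_w` is not of type `(1, ℤ/lℤ)±` ([EtTh]
Def. 2.5 (i)). So the honest constructor must CHOOSE the section through admissible places. Here:
* `vSectionThrough E K Q` — a section of `V(K) ↠ V_mod` passing, above every `v` that HAS a place
  satisfying `Q`, through such a place (elsewhere an arbitrary lift); `toVMod_vSectionThrough`,
  `VSectionThrough_bijOn`, `vSectionThrough_spec`;
* `InitialThetaData.ofArithChoice` — the smart constructor with the PRINT-LEVEL hypothesis
  `hbad : ∀ v ∈ V^bad_mod, ∃ w over v, IsTypeOneZModLPM w ∧ IsCanonicalGeneratorCusp w` (the existence that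
  [IUTchIV] Cor. 2.2 (ii) p. 46 invokes), and its `exists` form;
* the same for the model chain of `InitialThetaDataOfModel(Places).lean`:
  `exists_initialThetaData_ofModelChoice`, `exists_initialThetaData_ofPlaceInputChoice`;
* `InitialThetaData.hbad_of_forall` — the universal hypotheses imply the existential one (so nothing typed
  over the old constructors is lost).
-/

noncomputable section

namespace Literature.IUT.HodgeTheaters

open NumberField
open scoped Classical

universe u

variable {F : Type u} [Field F] [NumberField F] (E : WeierstrassCurve F) [E.IsElliptic] (l : ℕ)

/-! ## A section of `V(K) ↠ V_mod` through prescribed places -/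

section Through
variable (K : Type u) [Field K] [NumberField K] [Algebra F K] (Q : Val K → Prop)

/-- A section `V_mod → V(K)` of the restriction of valuations which, above every `v ∈ V_mod` admitting a
place `w` with `Q w`, passes through such a place (Def. 3.1 (e): `V̲` "a section of the natural surjection
`V(K) ↠ V_mod`", to be chosen so that the bad-place clauses of (e)/(f) hold).
[cite: Mochizuki2012, IUTchI Def 3.1 (e) p.62] -/
def vSectionThrough (v : Val (fieldOfModuli E)) : Val K :=
  if h : ∃ w : Val K, toVMod F K E w = v ∧ Q w then h.choose else vSection E K v

/-- The chosen map is a section: `v̲ ↦ v`. [cite: Mochizuki2012, IUTchI Def 3.1 (e) p.62] -/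
theorem toVMod_vSectionThrough (v : Val (fieldOfModuli E)) :
    toVMod F K E (vSectionThrough E K Q v) = v := by
  unfold vSectionThrough
  split_ifs with h
  · exact h.choose_spec.1
  · exact toVMod_vSection E K v

/-- Above a `v` that admits a `Q`-place, the chosen place satisfies `Q`.
[cite: Mochizuki2012, IUTchI Def 3.1 (e) p.62] -/
theorem vSectionThrough_spec (v : Val (fieldOfModuli E)) (h : ∃ w : Val K, toVMod F K E w = v ∧ Q w) :
    Q (vSectionThrough E K Q v) := by
  unfold vSectionThrough
  rw [dif_pos h]
  exact h.choose_spec.2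

/-- `V̲ :=` the image of the chosen section. [cite: Mochizuki2012, IUTchI Def 3.1 (e) p.62] -/
def VSectionThrough : Set (Val K) := Set.range (vSectionThrough E K Q)

/-- `V̲ ⥲ V_mod` is a bijection (Def. 3.1 (e)). [cite: Mochizuki2012, IUTchI Def 3.1 (e) p.62] -/
theorem VSectionThrough_bijOn : Set.BijOn (toVMod F K E) (VSectionThrough E K Q) Set.univ := by
  refine ⟨fun _ _ => Set.mem_univ _, ?_, ?_⟩
  · rintro _ ⟨a, rfl⟩ _ ⟨b, rfl⟩ h
    rw [toVMod_vSectionThrough, toVMod_vSectionThrough] at h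
    rw [h]
  · intro v _
    exact ⟨vSectionThrough E K Q v, ⟨v, rfl⟩, toVMod_vSectionThrough E K Q v⟩

/-- A place of `V̲` lying over a `v` that admits a `Q`-place satisfies `Q` (the form in which the bad-place
clauses are consumed). [cite: Mochizuki2012, IUTchI Def 3.1 (e) p.62] -/
theorem of_mem_VSectionThrough {w : Val K} (hw : w ∈ VSectionThrough E K Q)
    (h : ∃ w' : Val K, toVMod F K E w' = toVMod F K E w ∧ Q w') : Q w := by
  obtain ⟨v, rfl⟩ := hw
  rw [toVMod_vSectionThrough] at h
  exact vSectionThrough_spec E K Q v h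

end Through

/-! ## The smart constructor with the print-level bad-place hypothesis -/

/-- **[IUTchI] Def. 3.1 from its arithmetic clauses + the geometry interface, with `V̲` CHOSEN through
admissible bad places**: as `InitialThetaData.ofArith`, but the two clauses "`C̲_v̲` is of type `(1, ℤ/lℤ)±`"
(e) and "`ε̲_v̲` arises from the canonical generator" (f) are assumed only in the printed EXISTENTIAL form —
above every `v ∈ V^bad_mod` SOME place of `K` satisfies both — and `V̲` is a section through such places.
[cite: Mochizuki2012, IUTchI Def 3.1 (e) p.62] -/
def InitialThetaData.ofArithChoice (A : ArithInput E l) [NeZero l]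
    (Pb : BadPlacePredicates (TorsionField E l))
    (geom : ThetaGeometry.{u} (AlgebraicClosure F ≃ₐ[F] AlgebraicClosure F)
      (galoisSubgroupOf F (TorsionField E l) (AlgebraicClosure F)) l)
    (hbad : ∀ v : Val (fieldOfModuli E), v ∈ Val.non '' A.VbadMod →
      ∃ w : Val (TorsionField E l), toVMod F (TorsionField E l) E w = v ∧
        (Pb.IsTypeOneZModLPM w ∧ Pb.IsCanonicalGeneratorCusp w)) :
    InitialThetaData F (TorsionField E l) (AlgebraicClosure F) E l Pb where
  sqrt_neg_one_mem := A.sqrt_neg_one_mem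
  isSemistable := A.isSemistable
  VbadMod := A.VbadMod
  VbadMod_nonempty := A.VbadMod_nonempty
  VbadMod_odd := A.VbadMod_odd
  multiplicative_over_VbadMod := A.multiplicative_over_VbadMod
  isGalois_fieldOfModuli := A.isGalois_fieldOfModuli
  finrank_coprime := A.finrank_coprime
  torsion_six_rational := A.torsion_six_rational
  l_prime := A.l_prime
  five_le_l := A.five_le_l
  imageContainsSL2 := A.imageContainsSL2
  range_K_iff := TorsionField.range_iff E l
  l_ne_residueChar := A.l_ne_residueChar
  l_coprime_qParamOrd := A.l_coprime_qParamOrd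
  geom := geom
  V := VSectionThrough E (TorsionField E l) fun w => Pb.IsTypeOneZModLPM w ∧ Pb.IsCanonicalGeneratorCusp w
  V_bijOn := VSectionThrough_bijOn E (TorsionField E l) _
  bad_type := fun _ hw hbw =>
    (of_mem_VSectionThrough E (TorsionField E l) _ hw (hbad _ hbw)).1
  bad_cusp := fun _ hw hbw =>
    (of_mem_VSectionThrough E (TorsionField E l) _ hw (hbad _ hbw)).2

/-- The constructed datum has `V^bad_mod` as given. [cite: Mochizuki2012, IUTchI Def 3.1 (e) p.62] -/
theorem InitialThetaData.ofArithChoice_VbadMod (A : ArithInput E l) [NeZero l]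
    (Pb : BadPlacePredicates (TorsionField E l))
    (geom : ThetaGeometry.{u} (AlgebraicClosure F ≃ₐ[F] AlgebraicClosure F)
      (galoisSubgroupOf F (TorsionField E l) (AlgebraicClosure F)) l)
    (hbad : ∀ v : Val (fieldOfModuli E), v ∈ Val.non '' A.VbadMod →
      ∃ w : Val (TorsionField E l), toVMod F (TorsionField E l) E w = v ∧
        (Pb.IsTypeOneZModLPM w ∧ Pb.IsCanonicalGeneratorCusp w)) :
    (InitialThetaData.ofArithChoice E l A Pb geom hbad).VbadMod = A.VbadMod := rfl

/-- **Existence form with the printed hypothesis** ([IUTchIV] Cor. 2.2 (ii) p. 46: "there exist data `C̲_K`,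
`V̲`, `ε̲` such that all of the conditions … are satisfied"): from the arithmetic input, ANY geometry datum,
and — above each bad place of `F_mod` — the EXISTENCE of one place of `K` at which the two bad-place clauses
hold, initial Θ-data with the given `V^bad_mod` exist. [cite: Mochizuki2012, IUTchI Def 3.1 (e) p.62] -/
theorem InitialThetaData.exists_ofArithChoice (A : ArithInput E l) [NeZero l]
    (Pb : BadPlacePredicates (TorsionField E l))
    (geom : ThetaGeometry.{u} (AlgebraicClosure F ≃ₐ[F] AlgebraicClosure F)
      (galoisSubgroupOf F (TorsionField E l) (AlgebraicClosure F)) l)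
    (hbad : ∀ v : Val (fieldOfModuli E), v ∈ Val.non '' A.VbadMod →
      ∃ w : Val (TorsionField E l), toVMod F (TorsionField E l) E w = v ∧
        (Pb.IsTypeOneZModLPM w ∧ Pb.IsCanonicalGeneratorCusp w)) :
    ∃ D : InitialThetaData F (TorsionField E l) (AlgebraicClosure F) E l Pb, D.VbadMod = A.VbadMod :=
  ⟨InitialThetaData.ofArithChoice E l A Pb geom hbad, rfl⟩

/-- The universal hypotheses of `InitialThetaData.ofArith` IMPLY the existential one used here (so this
constructor applies wherever the other does; the converse fails in the intended model — see the module
docstring). [cite: Mochizuki2012, IUTchI Def 3.1 (e) p.62] -/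
theorem InitialThetaData.hbad_of_forall (A : ArithInput E l) [NeZero l]
    (Pb : BadPlacePredicates (TorsionField E l))
    (hbad_type : ∀ w : Val (TorsionField E l),
      toVMod F (TorsionField E l) E w ∈ Val.non '' A.VbadMod → Pb.IsTypeOneZModLPM w)
    (hbad_cusp : ∀ w : Val (TorsionField E l),
      toVMod F (TorsionField E l) E w ∈ Val.non '' A.VbadMod → Pb.IsCanonicalGeneratorCusp w) :
    ∀ v : Val (fieldOfModuli E), v ∈ Val.non '' A.VbadMod →
      ∃ w : Val (TorsionField E l), toVMod F (TorsionField E l) E w = v ∧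
        (Pb.IsTypeOneZModLPM w ∧ Pb.IsCanonicalGeneratorCusp w) := by
  haveI : NeZero l := A.neZero_l
  intro v hv
  obtain ⟨w, hw⟩ := toVMod_surjective E (TorsionField E l) v
  exact ⟨w, hw, hbad_type w (hw ▸ hv), hbad_cusp w (hw ▸ hv)⟩

/-! ## The model chain ([IUTchIV] Cor. 2.2 (ii) (P7)) with the print-level bad-place hypothesis -/

section Model
open Literature.NumberTheory.EllipticCurves

variable {K₀ : Type u} [Field K₀] [NumberField K₀] (W : WeierstrassCurve K₀) [W.IsElliptic]

/-- **[IUTchIV] Cor. 2.2 (ii), (P7), arithmetic half — EXISTENCE of initial Θ-data on `E_F = W ⊗ F`** (as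
`exists_initialThetaData_ofModel`), with the bad-place clauses of [IUTchI] Def. 3.1 (e)/(f) in the printed
EXISTENTIAL form (above each bad place of `F_mod` SOME place of `K` satisfies them) instead of at every place.
[cite: Mochizuki2012, IUTchI Def 3.1 (e) p.62] -/
theorem exists_initialThetaData_ofModelChoice (hgen : IntermediateField.adjoin ℚ {W.j} = ⊤) {l : ℕ}
    [NeZero l] (B : BadPlaceInput W l)
    (Pb : BadPlacePredicates (TorsionField (modelCurve W) l))
    (geom : ThetaGeometry.{u} (AlgebraicClosure (ThetaF W) ≃ₐ[ThetaF W] AlgebraicClosure (ThetaF W))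
      (galoisSubgroupOf (ThetaF W) (TorsionField (modelCurve W) l) (AlgebraicClosure (ThetaF W))) l)
    (hbad : ∀ v : Val (fieldOfModuli (modelCurve W)), v ∈ Val.non '' B.VbadMod →
      ∃ w : Val (TorsionField (modelCurve W) l),
        toVMod (ThetaF W) (TorsionField (modelCurve W) l) (modelCurve W) w = v ∧
          (Pb.IsTypeOneZModLPM w ∧ Pb.IsCanonicalGeneratorCusp w)) :
    ∃ D : InitialThetaData (ThetaF W) (TorsionField (modelCurve W) l) (AlgebraicClosure (ThetaF W))
        (modelCurve W) l Pb, D.VbadMod = B.VbadMod :=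
  InitialThetaData.exists_ofArithChoice (modelCurve W) l (arithInputOfModel W hgen B) Pb geom hbad

/-- **[IUTchIV] Cor. 2.2 (ii) (P7), arithmetic half, from `F`-level data** (as
`exists_initialThetaData_ofPlaceInput`), with the print-level existential bad-place hypothesis.
[cite: Mochizuki2012, IUTchI Def 3.1 (e) p.62] -/
theorem exists_initialThetaData_ofPlaceInputChoice (hgen : IntermediateField.adjoin ℚ {W.j} = ⊤) {l : ℕ}
    [NeZero l] (I : PlaceInput W l)
    (Pb : BadPlacePredicates (TorsionField (modelCurve W) l))
    (geom : ThetaGeometry.{u} (AlgebraicClosure (ThetaF W) ≃ₐ[ThetaF W] AlgebraicClosure (ThetaF W))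
      (galoisSubgroupOf (ThetaF W) (TorsionField (modelCurve W) l) (AlgebraicClosure (ThetaF W))) l)
    (hbad : ∀ v : Val (fieldOfModuli (modelCurve W)), v ∈ Val.non '' VbadModOf W l →
      ∃ w : Val (TorsionField (modelCurve W) l),
        toVMod (ThetaF W) (TorsionField (modelCurve W) l) (modelCurve W) w = v ∧
          (Pb.IsTypeOneZModLPM w ∧ Pb.IsCanonicalGeneratorCusp w)) :
    ∃ D : InitialThetaData (ThetaF W) (TorsionField (modelCurve W) l) (AlgebraicClosure (ThetaF W))
        (modelCurve W) l Pb, D.VbadMod = VbadModOf W l :=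
  exists_initialThetaData_ofModelChoice W hgen (badPlaceInputOf W hgen I) Pb geom hbad

end Model

end Literature.IUT.HodgeTheaters

end
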